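import Summits.AnomalousDissipation.AnomalousDissipation.Theses.QuarticLadder
import Summits.AnomalousDissipation.AnomalousDissipation.Theses.MomentParity
import Summits.AnomalousDissipation.AnomalousDissipation.Theorems.MomentParityQuarticGateSurgery
import Summits.AnomalousDissipation.AnomalousDissipation.Theorems.MomentParityQuarticGateStubOrder3SurgerySym
import Summits.AnomalousDissipation.AnomalousDissipation.Theorems.MomentParityQuarticGateStubOrder2DesignSym
import Summits.AnomalousDissipation.AnomalousDissipation.Theorems.MomentParityQuarticGateStubAxialDefect
import Summits.AnomalousDissipation.AnomalousDissipation.Theorems.MomentParityQuarticGateStubAxialQuadRigidity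
import Summits.AnomalousDissipation.AnomalousDissipation.Theorems.QuarticLadderQuarticGateNoTowerCalculus
import Summits.AnomalousDissipation.AnomalousDissipation.Theorems.QuarticLadderQuarticGateNoTowerDictionary
import Summits.AnomalousDissipation.AnomalousDissipation.Theorems.QuarticLadderQuarticGateCubicRowSurgery
import Summits.AnomalousDissipation.AnomalousDissipation.Theorems.QuarticLadderQuarticGateRowCertificate

/-!
# `QuarticGate` (stmt-AnomalousDissipation-11464) — PROOF, line `dissipative-tower`

The crux `Summit.AnomalousDissipation.AnomalousDissipation.Theses.QuarticLadder.QuarticGate`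
(= `…Theses.MomentParity.QuarticGate` verbatim; shared item, rank 2 of
route-AnomalousDissipation-QuarticLadder and of route-AnomalousDissipation-MomentParity): there is a
smooth solenoidal mean-zero force `f`, viscosities `ν_j → 0`, budgets `E`, `ε > 0` such that at
every
`j`, for infinitely many levels `N`, a level-`N` probability law with finite fourth moments is
4-STATIONARY for Galerkin NS (every polynomial observable of degree `≤ 3` drift-free) with mean
energy
`≤ E` and dissipation `≥ ε`.

Composition (the registered skeleton `Cruxes/QuarticGate/Lines/dissipative_tower_core.lean`, all
stubs
LANDED): `f, E, ε, ν₀` from the symmetric order-2 design S6′ (`stub_order2DesignSym`), `ν_j :=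
ν₀/(j+2)`;
at each `j` and EVERY `N ≥ max(N₀(ν_j), 2)` with `L := 2N+1`: S6′ gives the loud symmetric order-2
design
`μ₀`; S2q (`stub_axialQuadRigidity`) + S5a (`stub_axialDefect`) kill every quadratic Casimir row;
S5b
(`stub_order3SurgerySym`) gives a Slater 3-stationary `μ₁` with the same energy/dissipation; T = no
dissipative tower (`stub_noTowerDictionary ∘ stub_noTowerCalculus`: moment amplification) feeds S7
(`stub_cubicRowSurgery`), which re-shifts the third moments so that every cubic-Casimir row
vanishes;
S3″ (`stub_rowCertificate`) turns that into a plain defect certificate; S4 (`stub_surgery`) performs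
the
far-atom surgery. Honest caveat (Disproof §I, inherited by every surgery line): the typed crux is
decided
through the unnormalised fourth moment (far atoms chosen after `N`); `QuarticGateSupported` is not
claimed.
-/

-- `Summit.<Summit>.<Problem>`: mandated summit-side namespace (CONVENTIONS §2); deliberate.
set_option linter.dupNamespace false

namespace Summit.AnomalousDissipation.AnomalousDissipation.Theorems

open MeasureTheory Filter
open Literature.Analysis.FunctionSpaces Literature.Analysis.FluidPDE
open Summit.AnomalousDissipation.AnomalousDissipation.Theorems.QuarticGate.Negative

/-- **T — NO DISSIPATIVE TOWER over a cubic Casimir** (all levels `N`, all `ν ≠ 0`): a homogeneous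
cubic
band observable that is a Casimir of level-`N` Galerkin–Euler and whose `ν`-viscous derivative is
the
Euler derivative of some polynomial band observable vanishes on level-`N` fields. Modus ponens of
the
landed frame dictionary `stub_noTowerDictionary` and the landed calculus core `stub_noTowerCalculus`
(moment amplification). [folklore-new] -/
theorem noDissipativeTower :
    ∀ (N : ℕ) (ν : ℝ), ν ≠ 0 →
    ∀ (m : ℕ) (g : Fin m → UnitAddTorus (Fin 3) → EuclideanSpace ℝ (Fin 3))
      (P : MvPolynomial (Fin m) ℝ), (∀ i, IsBandTest N (g i)) → P.IsHomogeneous 3 →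
      (∀ u : Torus.energySpace (Fin 3), IsLevel N u →
        Torus.nsGeneratorPairing (d := Fin 3) 0 0 u (polyGrad g P u) = 0) →
    ∀ (m' : ℕ) (g' : Fin m' → UnitAddTorus (Fin 3) → EuclideanSpace ℝ (Fin 3))
      (Q : MvPolynomial (Fin m') ℝ), (∀ i, IsBandTest N (g' i)) →
      (∀ u : Torus.energySpace (Fin 3), IsLevel N u →
        Torus.nsGeneratorPairing (d := Fin 3) 0 0 u (polyGrad g' Q u) =
          Torus.nsGeneratorPairing (d := Fin 3) ν 0 u (polyGrad g P u)) →
    ∀ u : Torus.energySpace (Fin 3), IsLevel N u →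
      MvPolynomial.eval (fun j => Torus.pairing u.1 (g j)) P = 0 :=
  QuarticLadderQuarticGate.stub_noTowerDictionary
    (fun h q V D P κ d => QuarticLadderQuarticGate.stub_noTowerCalculus h q V D P κ d)

/-- **`QuarticGate` — PROOF** (line `dissipative-tower`; see the module docstring for the
composition).
Closes the crux item stmt-AnomalousDissipation-11464 under its `QuarticLadder` name. -/
theorem quarticGate_proof :
    Summit.AnomalousDissipation.AnomalousDissipation.Theses.QuarticLadder.QuarticGate := by
  obtain ⟨f, hfs, hfd, hfz, hfsym, E, ε, ν₀, hε, hν₀, hK1⟩ :=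
    MomentParityQuarticGate.stub_order2DesignSym
  have hνpos : ∀ j : ℕ, 0 < ν₀ / ((j : ℝ) + 2) := fun j => div_pos hν₀ (by positivity)
  have hνlt : ∀ j : ℕ, ν₀ / ((j : ℝ) + 2) < ν₀ := fun j => by
    rw [div_lt_iff₀ (by positivity)]
    nlinarith [(Nat.cast_nonneg j : (0 : ℝ) ≤ j)]
  have hνlim : Tendsto (fun j : ℕ => ν₀ / ((j : ℝ) + 2)) atTop (nhds 0) :=
    tendsto_const_nhds.div_atTop
      (tendsto_atTop_add_const_right atTop (2 : ℝ) tendsto_natCast_atTop_atTop)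
  refine ⟨f, hfs, hfd, hfz, fun j => ν₀ / ((j : ℝ) + 2), E, ε, hνpos, hνlim, hε, fun j => ?_⟩
  obtain ⟨N₀, hN₀⟩ := hK1 _ (hνpos j) (hνlt j)
  refine Filter.Eventually.frequently ?_
  filter_upwards [eventually_ge_atTop N₀, eventually_ge_atTop 2] with N hN h2
  obtain ⟨μ₀, hp₀, hl₀, hR₀, hnd₀, hsym₀, hlin₀, hErow₀, hHrow₀, hE₀, hD₀⟩ :=
    hN₀ N hN (2 * N + 1) (Nat.succ_pos _)
  have hQuad := MomentParityQuarticGate.stub_axialQuadRigidity N h2 (2 * N + 1) (by omega)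
  have hCas := MomentParityQuarticGate.stub_axialDefect _ f N (2 * N + 1) μ₀ hfs hfsym (by omega)
    hp₀ hl₀ hR₀ hsym₀ hErow₀ hHrow₀ hQuad
  obtain ⟨μ₁, hp₁, hl₁, hi₁, hsl₁, hst₁, -, hE₁, hD₁⟩ :=
    MomentParityQuarticGate.stub_order3SurgerySym _ f N (2 * N + 1) μ₀ hfs hfsym (Nat.succ_pos _)
      hp₀ hl₀ hR₀ hnd₀ hsym₀ hlin₀ (fun m g P hg hP hC => (hCas m g P hg hP hC).2)
  have hT := noDissipativeTower N (ν₀ / ((j : ℝ) + 2)) (hνpos j).ne'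
  obtain ⟨μ₂, hp₂, hl₂, hi₂, hsl₂, hst₂, hrow₂, hE₂, hD₂⟩ :=
    QuarticLadderQuarticGate.stub_cubicRowSurgery _ f N μ₁ (hνpos j).ne' hfs hp₁ hl₁ hi₁ hsl₁
      hst₁ hT
  obtain ⟨M, v, c, hcert⟩ :=
    QuarticLadderQuarticGate.stub_rowCertificate N _ f hfs μ₂ hp₂ hl₂ hi₂
      (fun m g P hg hP hC => (hrow₂ m g P hg hP hC).2)
  obtain ⟨μ, hp, hl, hi, hst, hE, hD⟩ :=
    MomentParityQuarticGate.stub_surgery _ f N μ₂ hfs hp₂ hl₂ hi₂ hsl₂ hst₂ M v c hcert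
  refine ⟨μ, hp, hl, hi, hst, ?_, ?_⟩
  · rw [hE, hE₂, hE₁]; exact hE₀
  · rw [hD, hD₂, hD₁]; exact hD₀

/-- **`QuarticGate` — PROOF under the `MomentParity` name of the shared crux** (the two route
declarations
are verbatim copies; definitional unfolding). -/
theorem quarticGate_momentParity_proof :
    Summit.AnomalousDissipation.AnomalousDissipation.Theses.MomentParity.QuarticGate :=
  quarticGate_proof

end Summit.AnomalousDissipation.AnomalousDissipation.Theorems
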